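import Summits.Ventures.PercRepro.Night2LocalD2R14LargeCol
import Summits.Ventures.PercRepro.Night2LocalD2KOneSplit

/-!
# PercRepro — the (6,4) shadow row modulo the six-element columns of R1₄ (night-2, gen 16)

With the basis columns (`sum_r14W_col_le_of_card_five`, `|S| = 5`, gen 15) and THEOREM G
(`sum_r14W_col_le_of_seven_le`, `|S| ≥ 7`, Night2LocalD2R14LargeCol), the conditional assembly
`localShadowHall_of_r14W_columns` closes Case A of the coloop cell once the columns at the six-element shadow sets are
bounded:

* `four_le_rkN_erase_erase_of_kColoops_eq_one`: with `kColoops M G = 1` the flat `G ∖ {y}` has no coloop;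
* **`localShadowHall_caseA_of_six_columns`**: (LI_G) in Case A modulo «every column of R1₄ at `|S| = 6` is `≤ 1`»;
* **`shadowHall_six_four_of_six_columns`**: THE (6,4) SHADOW ROW FOR EVERY FINITE MATROID modulo the six-element
  columns of R1₄ in the coloop cell of simple loopless rank-`6` matroids (Case A).
-/

namespace PercRepro.Shadow

open Finset PerFlat ThmH

variable {α : Type*} [DecidableEq α] {M : Matroid α} [M.Finite]

open scoped Classical in
/-- With exactly one coloop `y` of `M|G`, the flat `G ∖ {y}` has no coloop: a coloop `z` of `G ∖ {y}` would be a
second coloop of `M|G`. -/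
theorem four_le_rkN_erase_erase_of_kColoops_eq_one {G : Finset α} (hG : G ∈ flatsQ M (4 + 1))
    (hk : kColoops M G = 1) {y : α} (hyG : y ∈ G) (hyc : y ∉ clF M (G.erase y)) :
    ∀ z ∈ G.erase y, 4 ≤ rkN M ((G.erase y).erase z) := by
  intro z hz
  have hGg : G ⊆ gr M := (mem_flatsQ.1 hG).1
  rw [Finset.mem_erase] at hz
  by_contra hcon
  push Not at hcon
  -- `z` is a coloop of `M|G`
  have hzc : z ∉ clF M (G.erase z) := by
    intro hzcl
    have h1 : G.erase z = insert y ((G.erase y).erase z) := by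
      ext e
      simp only [Finset.mem_erase, Finset.mem_insert]
      constructor
      · rintro ⟨hez, heG⟩
        by_cases hey : e = y
        · exact Or.inl hey
        · exact Or.inr ⟨hez, hey, heG⟩
      · rintro (rfl | ⟨hez, -, heG⟩)
        · exact ⟨fun h => hz.1 h.symm, hyG⟩
        · exact ⟨hez, heG⟩
    have h2 := rkN_insert_coloop_eq hGg hyG hyc (Finset.erase_subset _ _ : (G.erase y).erase z ⊆ G.erase y)
    rw [← h1] at h2
    have h3 : rkN M G ≤ rkN M (G.erase z) := by
      have h4 := rkN_insert_le_of_mem_clF (M := M) ((Finset.erase_subset _ _).trans hGg) hzcl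
      rw [Finset.insert_erase hz.2] at h4
      exact h4
    have h5 := rkN_eq_of_mem_flatsQ hG
    omega
  -- so the coloop set `{y}` contains `z`
  unfold kColoops at hk
  have hyF : y ∈ G.filter (fun y => y ∉ clF M (G.erase y)) := Finset.mem_filter.2 ⟨hyG, hyc⟩
  have hzF : z ∈ G.filter (fun y => y ∉ clF M (G.erase y)) := Finset.mem_filter.2 ⟨hz.2, hzc⟩
  have := Finset.card_le_one.1 (le_of_eq hk) z hzF y hyF
  exact hz.1 this

/-- A shadow set at the diagonal `(6, 4)` has at least five elements. -/
theorem five_le_card_of_mem_shadowAt {G S : Finset α} (hS : S ∈ shadowAt M (4 + 2) 4 (Uq M (4 + 2) 4) G) :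
    5 ≤ S.card := by
  have h1 := rkN_eq_five_of_mem_shadowAt hS
  have h2 := rkN_le_card_fin (M := M) S
  omega

open scoped Classical in
/-- **(LI_G) in Case A of the coloop cell, modulo the columns of R1₄ at the six-element shadow sets.** -/
theorem localShadowHall_caseA_of_six_columns {G : Finset α} (hG : G ∈ flatsQ M (4 + 1)) (hd : (gr M \ G).card = 2)
    (hsimple : ∀ e ∈ gr M, ∀ f ∈ gr M, e ≠ f → rkN M {e, f} = 2) (hk : kColoops M G = 1) {y : α} (hyG : y ∈ G)
    (hyc : y ∉ clF M (G.erase y))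
    (hcol6 : ∀ S ∈ shadowAt M (4 + 2) 4 (Uq M (4 + 2) 4) G, S.card = 6 →
      ∑ B ∈ membersIn M (Uq M (4 + 2) 4) G, r14W M G B S ≤ 1) :
    LocalShadowHall M 4 G := by
  have hP := four_le_rkN_erase_erase_of_kColoops_eq_one hG hk hyG hyc
  apply localShadowHall_of_r14W_columns hG hd
  intro S hS
  have h5 := five_le_card_of_mem_shadowAt hS
  rcases Nat.lt_or_ge S.card 6 with h | h
  · exact sum_r14W_col_le_of_card_five hG hyG hyc hP hS (by omega)
  · rcases Nat.lt_or_ge S.card 7 with h' | h'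
    · exact hcol6 S hS (by omega)
    · exact sum_r14W_col_le_of_seven_le hG hd hsimple hyG hyc hP hS h'

section SixFour

variable {α' : Type} [DecidableEq α']

/-- **THE `(6, 4)` SHADOW ROW FOR EVERY FINITE MATROID, MODULO THE SIX-ELEMENT COLUMNS OF R1₄** in Case A of the
coloop cell of loopless simple rank-`6` matroids (`G ∈ flatsQ N 5`, `|E ∖ G| = 2`, `kColoops N G = 1`, `y` the coloop,
`ρ(E ∖ y) = 6`): every column of the rule R1₄ at a shadow set with six elements is at most `1`. -/
theorem shadowHall_six_four_of_six_columns
    (hsix : ∀ (N : Matroid α') [N.Finite], (∀ e ∈ gr N, ∀ f ∈ gr N, e ≠ f → rkN N {e, f} = 2) →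
      (∀ e ∈ gr N, N.Indep {e}) → N.eRank = ((6 : ℕ) : ℕ∞) →
      ∀ G ∈ flatsQ N (4 + 1), (gr N \ G).card = 2 → kColoops N G = 1 →
      ∀ y ∈ G, y ∉ clF N (G.erase y) → 6 ≤ rkN N ((gr N).erase y) →
      ∀ S ∈ shadowAt N (4 + 2) 4 (Uq N (4 + 2) 4) G, S.card = 6 →
        ∑ B ∈ membersIn N (Uq N (4 + 2) 4) G, r14W N G B S ≤ 1)
    (M : Matroid α') [M.Finite] : ShadowHall M 6 4 (phiK 6 4) := by
  apply shadowHall_six_four_of_local_caseA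
  intro N _ hs hl hr G hG hd hk y hyG hyc hr6
  exact localShadowHall_caseA_of_six_columns hG hd hs hk hyG hyc (hsix N hs hl hr G hG hd hk y hyG hyc hr6)

end SixFour

end PercRepro.Shadow
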